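import Summits.QuantumFields.YangMills.Theorems.BalabanLadderIRPurityClimbAll
import HarnessLib

/-!
# The purity bootstrap scale is UNIVERSAL: `N(ε)` doublings take every `1/24`-pure cold box to `ε`-purity — and `H ⇔ H(1/24)` (content-free helper)

Ideator ym-ir-idea-11 g0, line `thermal-ratchet` (lens «finite»: reduction first) on crux `BalabanLadder.IR` (stmt-QuantumFields-19354, rung R2c).
Sharpening of `PurityClimbAll` (p607811): the number of doublings needed to pass from `δᶜ ≤ 1/24` to `δᶜ ≤ ε` depends on `ε` ONLY — not on
the group `G`, the representation, the coupling `β ≥ 0` or the box `L ≥ 8` (`coldDefect_anyPurity_uniform`: one `N(ε) ≥ 1` for all of them;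
`N = 2^{14+n(ε)}` from `coldDefect_widen_24` and `boxDefect_iterate9`).  Consequence for line `floor-handshake` (★ bill `{H, N}`):
the handshake `H = FloorToPuritySC` (floor at resolution `s` ⇒ an `ε₀`-pure box in the window `[1/s, k/s]`, for EVERY tolerance `ε₀ > 0`)
follows from its single-tolerance case `ε₀ = 1/24` with the window widened to `[1/s, N(ε₀)·k/s]` — `floorToPuritySC_of_tolerance24`
(hypothesis = `FloorToPuritySC` with `ε₀` frozen at `1/24`, written out; no new `def`).  So BOTH one-scale obligations of the IR cell, the exit
`E` (`coldExitSC_iff_coldExitAt24`) and the handshake `H`, are few-percent statements.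

HONEST FRAMING.  Content-free real arithmetic over landed theorems; nothing here proves the Yang–Mills mass gap (Clay), the crux `IR`, `E`, `H`
or a lattice gap; R4 (`BalabanUVStability4`) closes only the conditional finite-`𝕋⁴` rung `BalabanLadder.UV`.
-/

open MeasureTheory Filter Topology
open scoped SchwartzMap
open Literature.MathematicalPhysics.QuantumFieldTheory Literature.MathematicalPhysics.QuantumLattice
open Summit.QuantumFields.YangMills.Cruxes.OSLegsFromFemtoAndGap.DlrCollarTransfer (Q2)
open Summit.QuantumFields.YangMills.Cruxes.IR.ColdPurityBridge (coldDefect FloorToPuritySC)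
open Summit.QuantumFields.YangMills.Cruxes.IR.AspectBootstrap (boxDefect coldDefect_eq_boxDefect axisSymmetric tracePositive volumeBounds)

namespace Summit.QuantumFields.YangMills.Cruxes.IR.PurityClimb

/-- **Universal bootstrap scale.**  For every `ε > 0` ONE factor `N ≥ 1` works for every compact `G`, every lattice representation, every
`β ≥ 0` and every `L ≥ 8`: `δᶜ_β(L) ≤ 1/24 ⇒ δᶜ_β(N·L) ≤ ε`. -/
theorem coldDefect_anyPurity_uniform {ε : ℝ} (hε : 0 < ε) :
    ∃ N : ℕ, 1 ≤ N ∧ ∀ (G : Type) [Group G] [TopologicalSpace G] [IsTopologicalGroup G] [CompactSpace G] [MeasurableSpace G]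
      [BorelSpace G] (r : LatticeRep G) (β : ℝ), 0 ≤ β → ∀ L : ℕ, 8 ≤ L →
        coldDefect r.ρ β L ≤ 1 / 24 → coldDefect r.ρ β (N * L) ≤ ε := by
  obtain ⟨n, -, hn⟩ := iterate9_bound_small hε 0
  refine ⟨2 ^ n * 16384, ?_, ?_⟩
  · have h1 : 1 ≤ 2 ^ n := Nat.one_le_two_pow
    calc 1 ≤ 2 ^ n := h1
      _ ≤ 2 ^ n * 16384 := Nat.le_mul_of_pos_right _ (by norm_num)
  intro G _ _ _ _ _ _ r β hβ L hL h
  have hS := axisSymmetric r β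
  have hT := tracePositive r hβ
  have hV := volumeBounds r hβ
  have h9 : boxDefect (wilsonFinTorusPartition r.ρ β) (16384 * L) ≤ 1 / 2 ^ 9 := by
    rw [← coldDefect_eq_boxDefect]; exact (coldDefect_widen_24 r hβ L hL h).trans (by norm_num)
  have h8 : 8 ≤ 16384 * L := by omega
  rw [coldDefect_eq_boxDefect, show 2 ^ n * 16384 * L = 2 ^ n * (16384 * L) by ring]
  exact (boxDefect_iterate9 hS hT hV (16384 * L) h8 h9 n).trans hn

/-- **`H ⇔ H(1/24)`: the handshake at the single tolerance `1/24` implies `FloorToPuritySC` at every tolerance** (window factor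
`k ↦ N(ε₀)·k`, coupling threshold `β₀ ↦ max β₀ 0`).  The hypothesis is `FloorToPuritySC` with `ε₀` frozen at `1/24`, verbatim otherwise. -/
theorem floorToPuritySC_of_tolerance24
    (hH : ∀ (G : Type) [Group G] [TopologicalSpace G] [IsTopologicalGroup G] [CompactSpace G],
      IsCompactSimpleLieGroup G → SimplyConnectedSpace G →
      letI : MeasurableSpace G := borel G
      haveI : BorelSpace G := ⟨rfl⟩
      ∀ (r : LatticeRep G) (v : 𝓢(EuclideanSpace ℝ (Fin 4), ℝ)),
        tsupport v ⊆ {y : EuclideanSpace ℝ (Fin 4) | 0 < y 0} →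
        ∀ (ε Λ : ℝ), 0 < ε →
          ∃ (β₀ s₀ k : ℝ), 0 < s₀ ∧ ∀ β : ℝ, β₀ ≤ β → ∀ s : ℝ, 0 < s → s ≤ s₀ →
            (∀ L : ℕ, Λ ≤ s * L → ε ≤ Q2 G r β L s (thetaTest 4 v) v) →
              ∃ L' : ℕ, 8 ≤ L' ∧ 1 / s ≤ (L' : ℝ) ∧ (L' : ℝ) ≤ k / s ∧ coldDefect r.ρ β L' ≤ 1 / 24) :
    FloorToPuritySC := by
  intro G _ _ _ _ hG hsc
  letI : MeasurableSpace G := borel G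
  haveI : BorelSpace G := ⟨rfl⟩
  intro r v hv ε Λ ε₀ hε hε₀
  obtain ⟨N, hN1, hN⟩ := coldDefect_anyPurity_uniform hε₀
  obtain ⟨β₀, s₀, k, hs₀, hβ₀⟩ := hH G hG hsc r v hv ε Λ hε
  refine ⟨max β₀ 0, s₀, N * k, hs₀, fun β hβ s hs hss₀ hfloor => ?_⟩
  obtain ⟨L', hL', hlo, hhi, hδ⟩ := hβ₀ β ((le_max_left _ _).trans hβ) s hs hss₀ hfloor
  have hβ00 : 0 ≤ β := (le_max_right _ _).trans hβ
  have hN1' : (1 : ℝ) ≤ N := by exact_mod_cast hN1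
  have hL'0 : (0 : ℝ) ≤ L' := by exact_mod_cast (Nat.zero_le L')
  refine ⟨N * L', ?_, ?_, ?_, hN G r β hβ00 L' hL' hδ⟩
  · calc 8 ≤ L' := hL'
      _ = 1 * L' := (one_mul _).symm
      _ ≤ N * L' := Nat.mul_le_mul_right _ hN1
  · push_cast
    calc 1 / s ≤ (L' : ℝ) := hlo
      _ = 1 * L' := (one_mul _).symm
      _ ≤ N * L' := mul_le_mul_of_nonneg_right hN1' hL'0
  · push_cast
    rw [mul_div_assoc]
    exact mul_le_mul_of_nonneg_left hhi (by linarith)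

end Summit.QuantumFields.YangMills.Cruxes.IR.PurityClimb
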